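import Summits.NavierStokesRegularity.FluidComputer.PalasekTowerRegisterGlobalReball
import Summits.NavierStokesRegularity.FluidComputer.PalasekTowerChainGluing

/-!
# REGISTER v2.3′: heredity with a CONCLUSION-SIDE ball (drift allowance `ρ`) — the typed repair (r1) of the
# ball lever, its comparison with the items of record, and its closer to Clay (C)

Cell `ns-blowup`, seat `ns-blowup-fc-prover-3` (g4; D-0074 GROUP C/E «BRIDGE SUPPORT»; bears_on LADDER-NS N1,
route `PalasekTowerBreakdown`, cruxes stmt-NavierStokesRegularity-19249 / -19250 / -19178 — supported, NOT closed,
NOT re-filed: the items of record are untouched; this file only TYPES a candidate repair for the planner).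
Companion of `PalasekTowerRegisterGlobalReball.lean` (this seat, p457497: `Schedule.reball`, `Stage.reball` /
`reballOfLe` / `unreball`, the BALL LEVER `HeredityAt.readsIn_reball`) and `PalasekTowerChainGluing.lean`
(ecbridge-1, `Realisation.ofChain`). LABEL: E–C typing (KERNEL: two `@[conjecture]` predicates with a real
parameter, comparison lemmas, a chain construction and a closer; no named fact, no `sorry`). WHAT THIS IS NOT:
not Navier–Stokes evidence — `HeredityAtDrift`, `EpisodeInductionDrift` are OPEN statements appearing only as
hypotheses; no stage, flow or tower is constructed; nothing here bears on whether any of them holds.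

## Why (the ball lever, p457497 / p459061, and what a repair must keep)

The `∀`-items `HeredityAt k` ask the level-`(k+1)` readouts inside THE SAME ball `B̄(0, S.radius)` that the
hypothesis stage used; since the register pins neither the centre nor the radius of that ball (only that it
confines `(u₀, f)` and holds the readouts), the items force every later readout into EVERY admissible ball — an
unintended geometric conjunct. The cheapest repair that keeps everything else is a CONCLUSION-SIDE radius: the
extension stage may read level `k + 1` inside the enlarged ball `B̄(0, S.radius + ρ)` (`HeredityAtDrift k ρ`,
§1; `ρ = 0` is the item of record, `heredityAtDrift_zero_iff`; monotone in `ρ`; implied by `HeredityAt k` for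
every `ρ ≥ 0`). The residual content of the lever is then only «the readouts drift by at most `ρ` beyond every
admissible ball» (`HeredityAtDrift.readsIn_reball_add`). The repair must keep the TOTAL drift bounded: the bridge
to (C) reads the blow-up inside a bounded ball (`BreakdownWitness.unbounded` carries `‖x‖ ≤ radius`; compactness of
`[0, T] × B̄(0, radius)`), so §2–§3 prove the closer for a drift schedule `ρ : ℕ → ℝ` with `ρ ≥ 0` and bounded
partial sums: **`navierStokesBreakdownR3_of_episodesDrift :
EpisodeBaseG → EpisodeInductionDrift ρ → (∀ k, 0 ≤ ρ k) → (∀ n, Σ_{j<n} ρ (j+1) ≤ B) → NavierStokesBreakdownR3`**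
(no W14: PATH B closer `navierStokesBreakdownR3_of_step2_B`) — iterate the drift steps in the growing balls
`S.reball (radius + Σ_{j<n} ρ (j+1))` (`driftChain`, choice along `ℕ`), move every link into the bounded ball
`S.reball (radius + B)` (enlarging is free, `Stage.reballOfLe`), glue by `Realisation.ofChain`, rescale to every
viscosity (`palasekStep2_of_realisation`). A natural registered allowance is the distance a structure at the next
ceiling speed covers in the rigid window, `ρ_k = c₂ c₅ log N_{k+1} · Y_{k+1} / A_k` (super-geometrically summable on
the wide rates); the choice is the planner's, the closer is generic.

References: S. Palasek, arXiv:2605.13827 §3.3, §4 [cite: Palasek2026ElementaryModel, §4]; C. L. Fefferman, Clay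
problem description, (C) [cite: FeffermanClay2006, (C)].
-/

noncomputable section

namespace Summit.NavierStokesRegularity.FluidComputer.PalasekTowerClayBridge

open Set MeasureTheory Filter Topology Function Real
open scoped ENNReal ContDiff NNReal
open Literature.Analysis.FluidPDE

/-! ## §1 Heredity with a conclusion-side ball -/

/-- **Heredity AT level `k` WITH DRIFT ALLOWANCE `ρ`** (open; never asserted; the typed repair (r1) of the ball
lever): every globally anchored registered stage at level `k` of a pinned (`Λ = 8`, `θ = 6/5`), rigid, quiet wide
schedule `S` extends — same velocity and pressure on `[0, τ k]` — to a registered stage at level `k + 1` of the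
ENLARGED schedule `S.reball (S.radius + ρ)`: the level-`(k+1)` readouts (speed floor, strain floor, core loop) are
asked inside `B̄(0, radius + ρ)`, everything else (PDE, energy, ceilings, quiet clauses, anchor, rigidity) being
radius-free. At `ρ = 0` this is `HeredityAt k` (`heredityAtDrift_zero_iff`). [cite: Palasek2026ElementaryModel, §4] -/
@[conjecture] def HeredityAtDrift (k : ℕ) (ρ : ℝ) : Prop :=
  ∀ S : Schedule TowerRates.wide, S.Pins 8 (6 / 5) → S.Rigid → S.Quiet →
    ∀ s : Stage 1 TowerRates.wide S (Margins.routeG TowerRates.wide) k,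
      ∃ s' : Stage 1 TowerRates.wide (S.reball (S.radius + ρ)) (Margins.routeG TowerRates.wide) (k + 1),
        ∀ t ∈ Icc 0 (S.τ k), s'.u t = s.u t ∧ s'.p t = s.p t

/-- **The episode induction WITH A DRIFT SCHEDULE `ρ : ℕ → ℝ`** (open; never asserted): drift heredity at every
level `k ≥ 1` with allowance `ρ k`. At `ρ ≡ 0` this is K2G `EpisodeInductionG`. [cite: Palasek2026ElementaryModel, §4] -/
@[conjecture] def EpisodeInductionDrift (ρ : ℕ → ℝ) : Prop :=
  ∀ k : ℕ, 1 ≤ k → HeredityAtDrift k (ρ k)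

section Comparison

variable {k : ℕ} {ρ ρ' : ℝ}

/-- **The item of record implies every drift version** (`ρ ≥ 0`; enlarging the ball is free). [folklore] -/
theorem HeredityAt.drift (h : HeredityAt k) (hρ : 0 ≤ ρ) : HeredityAtDrift k ρ := by
  intro S hP hR hQ s
  obtain ⟨s', hs'⟩ := h S hP hR hQ s
  exact ⟨s'.reballOfLe (le_add_of_nonneg_right hρ), fun t ht => hs' t ht⟩

/-- Drift heredity is monotone in the allowance. [folklore] -/
theorem HeredityAtDrift.mono (h : HeredityAtDrift k ρ) (hρ : ρ ≤ ρ') : HeredityAtDrift k ρ' := by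
  intro S hP hR hQ s
  obtain ⟨s', hs'⟩ := h S hP hR hQ s
  exact ⟨s'.reballOfLe (show (S.reball (S.radius + ρ)).radius ≤ S.radius + ρ' by
    simp only [Schedule.reball_radius]; linarith), fun t ht => hs' t ht⟩

/-- **At zero allowance drift heredity IS the item of record.** [folklore] -/
theorem heredityAtDrift_zero_iff : HeredityAtDrift k 0 ↔ HeredityAt k := by
  constructor
  · intro h S hP hR hQ s
    obtain ⟨s', hs'⟩ := h S hP hR hQ s
    exact ⟨s'.unreball (by simp), fun t ht => hs' t ht⟩
  · exact fun h => h.drift le_rfl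

/-- K2G implies every drift induction with nonnegative allowances. [folklore] -/
theorem EpisodeInductionG.drift {ρ : ℕ → ℝ} (h : EpisodeInductionG) (hρ : ∀ k, 0 ≤ ρ k) :
    EpisodeInductionDrift ρ :=
  fun k hk => ((episodeInductionG_iff_heredityFrom_one.1 h).heredityAt hk).drift (hρ k)

/-- At zero allowances the drift induction IS K2G. [folklore] -/
theorem episodeInductionDrift_zero_iff : EpisodeInductionDrift (fun _ => 0) ↔ EpisodeInductionG := by
  rw [episodeInductionG_iff_heredityFrom_one]
  constructor
  · intro h S hP hR hQ k hk s
    exact heredityAtDrift_zero_iff.1 (h k hk) S hP hR hQ s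
  · intro h k hk
    exact heredityAtDrift_zero_iff.2 (h.heredityAt hk)

/-- **The residual content of the ball lever after the repair**: under `HeredityAtDrift k ρ`, every registered
level-`(k+1)` stage of the design reads level `k + 1` inside the `ρ`-ENLARGEMENT `B̄(0, r + ρ)` of every admissible
ball `B̄(0, r)` (confining `(u₀, f)`, reading the levels `j ≤ k`; W14-free, `Stage.velocity_eq_of_classical`) —
«the readouts drift by at most `ρ` beyond any admissible ball», and no more. [folklore] -/
theorem HeredityAtDrift.readsIn_reball_add (h : HeredityAtDrift k ρ) {S : Schedule TowerRates.wide}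
    (hP : S.Pins 8 (6 / 5)) (hR : S.Rigid) (hQ : S.Quiet)
    (s : Stage 1 TowerRates.wide S (Margins.routeG TowerRates.wide) k) {r : ℝ}
    (hc : S.ConfinedTo r) (hs : ∀ j, j ≤ k → S.ReadsIn j r (s.u (S.τ j)))
    {m' : Margins TowerRates.wide} (s'' : Stage 1 TowerRates.wide S m' (k + 1)) :
    S.ReadsIn (k + 1) (r + ρ) (s''.u (S.τ (k + 1))) := by
  obtain ⟨s₂, -⟩ := h (S.reball r) (hP.reball hc) (hR.reball r) (hQ.reball r) (s.reball r hs)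
  have heq : s''.u (S.τ (k + 1)) = s₂.u (S.τ (k + 1)) :=
    (s₂.velocity_eq_of_classical one_pos le_rfl s''.classical s''.initial s''.energy (S.τ (k + 1))
      ⟨(S.τ_pos _).le, le_rfl⟩)
  rw [heq]
  exact s₂.readsIn_radius le_rfl

end Comparison

/-! ## §2 The chain of a drift induction in growing balls -/

section Chain

variable (S : Schedule TowerRates.wide) (ρ : ℕ → ℝ)

/-- The radii of the growing balls: `driftRadius S ρ n = radius + Σ_{j<n} ρ (j+1)` (recursive form, so that
`driftRadius S ρ (n+1)` unfolds to `driftRadius S ρ n + ρ (n+1)`). [folklore] -/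
def driftRadius : ℕ → ℝ
  | 0 => S.radius
  | n + 1 => driftRadius n + ρ (n + 1)

/-- The recursion step of the radii. [folklore] -/
@[simp] theorem driftRadius_succ (n : ℕ) : driftRadius S ρ (n + 1) = driftRadius S ρ n + ρ (n + 1) := rfl

/-- The radii start at the schedule's radius. [folklore] -/
@[simp] theorem driftRadius_zero : driftRadius S ρ 0 = S.radius := rfl

/-- Closed form of the radii. [folklore] -/
theorem driftRadius_eq_sum (n : ℕ) :
    driftRadius S ρ n = S.radius + ∑ j ∈ Finset.range n, ρ (j + 1) := by
  induction n with
  | zero => simp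
  | succ n ih => rw [driftRadius_succ, ih, Finset.sum_range_succ]; ring

variable {S ρ}

/-- With nonnegative allowances the radii dominate the schedule's radius. [folklore] -/
theorem radius_le_driftRadius (hρ : ∀ k, 0 ≤ ρ k) (n : ℕ) : S.radius ≤ driftRadius S ρ n := by
  rw [driftRadius_eq_sum]
  have : 0 ≤ ∑ j ∈ Finset.range n, ρ (j + 1) := Finset.sum_nonneg fun j _ => hρ (j + 1)
  linarith

/-- With partial sums bounded by `B` the radii stay inside `radius + B`. [folklore] -/
theorem driftRadius_le {B : ℝ} (hB : ∀ n, ∑ j ∈ Finset.range n, ρ (j + 1) ≤ B) (n : ℕ) :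
    driftRadius S ρ n ≤ S.radius + B := by
  rw [driftRadius_eq_sum]
  linarith [hB n]

/-- **One drift step in the growing balls.** A registered stage at level `n + 1` of `S.reball (driftRadius S ρ n)`
extends, under `EpisodeInductionDrift ρ` (allowances `≥ 0`, `S` pinned rigid quiet), to a registered stage at
level `n + 2` of `S.reball (driftRadius S ρ (n + 1))`, same velocity and pressure on `[0, τ (n+1)]`. [folklore] -/
theorem drift_step (h : EpisodeInductionDrift ρ) (hρ : ∀ k, 0 ≤ ρ k) (hP : S.Pins 8 (6 / 5)) (hR : S.Rigid)
    (hQ : S.Quiet) (n : ℕ)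
    (s : Stage 1 TowerRates.wide (S.reball (driftRadius S ρ n)) (Margins.routeG TowerRates.wide) (n + 1)) :
    ∃ s' : Stage 1 TowerRates.wide (S.reball (driftRadius S ρ (n + 1))) (Margins.routeG TowerRates.wide)
      (n + 1 + 1), ∀ t ∈ Icc 0 (S.τ (n + 1)), s'.u t = s.u t ∧ s'.p t = s.p t := by
  obtain ⟨s', hs'⟩ := h (n + 1) (Nat.succ_pos n) (S.reball (driftRadius S ρ n))
    (hP.reball_of_le (radius_le_driftRadius hρ n)) (hR.reball _) (hQ.reball _) s
  exact ⟨s'.reballOfLe le_rfl, fun t ht => hs' t ht⟩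

/-- **The chain of a drift induction** from a registered level-`1` stage of `S`: link `n` is a registered stage
at level `n + 1` of `S.reball (driftRadius S ρ n)` (choice along `ℕ`). [folklore] -/
def driftChain (h : EpisodeInductionDrift ρ) (hρ : ∀ k, 0 ≤ ρ k) (hP : S.Pins 8 (6 / 5)) (hR : S.Rigid)
    (hQ : S.Quiet) (s₁ : Stage 1 TowerRates.wide S (Margins.routeG TowerRates.wide) 1) :
    (n : ℕ) → Stage 1 TowerRates.wide (S.reball (driftRadius S ρ n)) (Margins.routeG TowerRates.wide) (n + 1) :=
  fun n => Nat.rec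
    (motive := fun n =>
      Stage 1 TowerRates.wide (S.reball (driftRadius S ρ n)) (Margins.routeG TowerRates.wide) (n + 1))
    (s₁.reballOfLe le_rfl) (fun n s => Classical.choose (drift_step h hρ hP hR hQ n s)) n

/-- Consecutive links of the drift chain agree on the earlier slab. [folklore] -/
theorem driftChain_agree (h : EpisodeInductionDrift ρ) (hρ : ∀ k, 0 ≤ ρ k) (hP : S.Pins 8 (6 / 5))
    (hR : S.Rigid) (hQ : S.Quiet) (s₁ : Stage 1 TowerRates.wide S (Margins.routeG TowerRates.wide) 1) (n : ℕ) :
    ∀ t ∈ Icc 0 (S.τ (n + 1)), (driftChain h hρ hP hR hQ s₁ (n + 1)).u t = (driftChain h hρ hP hR hQ s₁ n).u t ∧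
      (driftChain h hρ hP hR hQ s₁ (n + 1)).p t = (driftChain h hρ hP hR hQ s₁ n).p t :=
  Classical.choose_spec (drift_step h hρ hP hR hQ n (driftChain h hρ hP hR hQ s₁ n))

/-- **The drift chain inside ONE bounded ball.** With partial sums of the allowances bounded by `B`, every link
moves into `S.reball (radius + B)` (enlarging is free), giving a coherent chain of registered stages of one pinned
rigid quiet schedule. [folklore] -/
theorem exists_chain_of_drift (h : EpisodeInductionDrift ρ) (hρ : ∀ k, 0 ≤ ρ k) {B : ℝ}
    (hB : ∀ n, ∑ j ∈ Finset.range n, ρ (j + 1) ≤ B) (hP : S.Pins 8 (6 / 5)) (hR : S.Rigid) (hQ : S.Quiet)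
    (s₁ : Stage 1 TowerRates.wide S (Margins.routeG TowerRates.wide) 1) :
    ∃ st : (n : ℕ) → Stage 1 TowerRates.wide (S.reball (S.radius + B)) (Margins.routeG TowerRates.wide) (n + 1),
      ∀ n, (st n).Extends (st (n + 1)) :=
  ⟨fun n => (driftChain h hρ hP hR hQ s₁ n).reballOfLe (driftRadius_le hB n),
    fun n t ht => driftChain_agree h hρ hP hR hQ s₁ n t ht⟩

end Chain

/-! ## §3 The closer: base + drift induction with bounded total drift ⇒ Clay (C) -/

/-- **K1G ∧ drift induction with bounded total drift ⇒ the interface is inhabited at unit viscosity**: the drift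
chain in the bounded ball, glued by `Realisation.ofChain`. [cite: Palasek2026ElementaryModel, §4] -/
theorem nonempty_realisation_of_episodesDrift {ρ : ℕ → ℝ} (h₁ : EpisodeBaseG) (h₂ : EpisodeInductionDrift ρ)
    (hρ : ∀ k, 0 ≤ ρ k) {B : ℝ} (hB : ∀ n, ∑ j ∈ Finset.range n, ρ (j + 1) ≤ B) :
    Nonempty (Realisation 1 TowerRates.wide) := by
  obtain ⟨S, hP, hR, hQ, ⟨s₁⟩⟩ := h₁
  obtain ⟨st, hst⟩ := exists_chain_of_drift h₂ hρ hB hP hR hQ s₁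
  exact ⟨Realisation.ofChain (S.reball (S.radius + B)) st hst⟩

/-- … hence Palasek's Step 2 for the wide rates (all viscosities, by rescaling). [cite: Palasek2026ElementaryModel, §4] -/
theorem palasekStep2_of_episodesDrift {ρ : ℕ → ℝ} (h₁ : EpisodeBaseG) (h₂ : EpisodeInductionDrift ρ)
    (hρ : ∀ k, 0 ≤ ρ k) {B : ℝ} (hB : ∀ n, ∑ j ∈ Finset.range n, ρ (j + 1) ≤ B) :
    PalasekStep2 TowerRates.wide := by
  obtain ⟨W⟩ := nonempty_realisation_of_episodesDrift h₁ h₂ hρ hB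
  exact palasekStep2_of_realisation one_pos W

/-- **CLOSER OF THE REPAIRED PAIR — no W14.** K1G `EpisodeBaseG`, the drift induction `EpisodeInductionDrift ρ`
with nonnegative allowances of bounded total, and the tree's PATH-B bridge (`navierStokesBreakdownR3_of_step2_B`,
forced Serrin–Masuda uniqueness, proved) give Fefferman's (C). The bounded total drift is exactly what the bridge
needs: the glued tower blows up inside the bounded ball `B̄(0, radius + B)`. Conditional on the two open pieces;
neither is asserted. [cite: FeffermanClay2006, (C)] -/
theorem navierStokesBreakdownR3_of_episodesDrift {ρ : ℕ → ℝ} (h₁ : EpisodeBaseG) (h₂ : EpisodeInductionDrift ρ)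
    (hρ : ∀ k, 0 ≤ ρ k) {B : ℝ} (hB : ∀ n, ∑ j ∈ Finset.range n, ρ (j + 1) ≤ B) :
    Summit.NavierStokesRegularity.NavierStokesRegularity.NavierStokesBreakdownR3 :=
  navierStokesBreakdownR3_of_step2_B TowerRates.wide (palasekStep2_of_episodesDrift h₁ h₂ hρ hB)

/-- **A summable allowance suffices** (bounded partial sums from `Summable` with nonnegative terms).
[cite: FeffermanClay2006, (C)] -/
theorem navierStokesBreakdownR3_of_episodesDrift_summable {ρ : ℕ → ℝ} (h₁ : EpisodeBaseG)
    (h₂ : EpisodeInductionDrift ρ) (hρ : ∀ k, 0 ≤ ρ k) (hsum : Summable ρ) :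
    Summit.NavierStokesRegularity.NavierStokesRegularity.NavierStokesBreakdownR3 := by
  have hsum' : Summable fun j => ρ (j + 1) := (summable_nat_add_iff 1).2 hsum
  refine navierStokesBreakdownR3_of_episodesDrift h₁ h₂ hρ (B := ∑' j, ρ (j + 1)) fun n => ?_
  exact hsum'.sum_le_tsum (Finset.range n) fun j _ => hρ (j + 1)

end Summit.NavierStokesRegularity.FluidComputer.PalasekTowerClayBridge

end
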